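import Literature.Computability.Complexity.UniformDerandomizationSelectByTesting
import HarnessLib

/-!
# Weak-to-strong constructions of circuits by testing, II: the reduction statement

Literature / complexity — derandomization under a uniform assumption; sequel of
`UniformDerandomizationSelectByTesting.lean` (the counting core: over `T = 4aP` independent trials,
each a run of a weak stage followed by a test of its candidate on `m = 64D²a²P` membership queries,
the first-accepted rule yields a candidate of error `≤ 2δ`, `δ = 1/D`, except with probability
`≤ 1/a`). This file packages the counting into Impagliazzo–Wigderson's `A →^{fₙ} C^{f,1−2δ}`
(`IWUniform.ReducibleUsing`, IW Def. 4) for ANY oracle algorithm whose run, against every oracle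
agreeing with `f` on `{0,1}^n`, outputs the candidate of the first accepted trial block
(`IWUniform.Select.selOut`) — the specification the transducer of the next file meets:

* `Selection.firstAcc_take` — the first-accepted rule reads only the first `T·c` coins;
* `IWUniform.Select.selOut` — the output: the candidate of the first accepted block, `ε` if none;
  `errProb_selOut_le` (outside `Selection.Bad` it has error `≤ 2δ`);
* **`IWUniform.Select.le_uniformProb_selOut_mem`** — for `z ∈ Aₙ`, over coin strings of any length
  `≥ T·c`, `selOut ∈ C^{f,1−2/D}` with probability `≥ 1 − 1/a`;
* **`IWUniform.reducibleUsing_of_selOut`** — hence `ReducibleUsing A (approxCircuits Ev f (2/D)) f id`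
  for a polynomial-time oracle algorithm with that run behaviour and polynomial coin length
  `≥ T·c`.

Everything is proved; no named facts.

## References

* [ImpagliazzoWigderson2001] R. Impagliazzo, A. Wigderson, JCSS 63 (2001) 672–688, Def. 4, §2.2
  (strong constructions), Lemma 14 and the proof of Lemma 18 (held text pp. 6–8).
* [AroraBarakCC2009] S. Arora, B. Barak, CUP 2009, §7.4.1.
-/

noncomputable section

namespace Literature.Computability.Complexity

open _root_.Computability Polynomial Real

/-! ### The first-accepted rule reads a prefix of the coins -/

namespace Selection

/-- **`firstAcc` on `t` blocks of `c` coins reads only the first `t·c` coins.** [folklore] -/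
theorem firstAcc_take (Acc : List Bool → Bool) (c : ℕ) :
    ∀ (t : ℕ) (r : List Bool), firstAcc Acc c t (r.take (t * c)) = firstAcc Acc c t r
  | 0, r => rfl
  | t + 1, r => by
    have htk : (r.take ((t + 1) * c)).take c = r.take c := by
      rw [List.take_take, min_eq_left (by nlinarith)]
    have hdr : (r.take ((t + 1) * c)).drop c = (r.drop c).take (t * c) := by
      rw [show (t + 1) * c = c + t * c by ring, List.drop_take, Nat.add_sub_cancel_left]
    simp only [firstAcc, htk, hdr, firstAcc_take Acc c t (r.drop c)]

/-- Membership in `Bad` depends only on the first `t·c` coins. [folklore] -/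
theorem mem_bad_iff_take (Acc : List Bool → Bool) (c : ℕ) (Good : Set (List Bool)) (t : ℕ) (r : List Bool) :
    r ∈ Bad Acc c Good t ↔ r.take (t * c) ∈ Bad Acc c Good t := by
  simp only [Bad, Set.mem_setOf_eq, firstAcc_take]

end Selection

namespace IWUniform

namespace Select

variable (Ev : List Bool → List Bool) (f : List Bool → Bool) (n : ℕ) (cand : List Bool → List Bool)
  (P₁ m : ℕ) (δ : ℝ) (T : ℕ)

/-- **The output of the selection**: the candidate of the first accepted trial block, `ε` if no
block is accepted. [cite: ImpagliazzoWigderson2001, Lemma 18 (proof: "output C, else repeat")] -/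
def selOut (r : List Bool) : List Bool :=
  match Selection.firstAcc (Acc Ev f n cand P₁ m δ) (P₁ + m * n) T r with
  | some w => cand (w.take P₁)
  | none => []

variable {Ev f n cand P₁ m δ T}

/-- Outside the failure event the output has error `≤ 2δ`. [folklore] -/
theorem errProb_selOut_le {r : List Bool}
    (hr : r ∉ Selection.Bad (Acc Ev f n cand P₁ m δ) (P₁ + m * n) (GoodTrial Ev f n cand P₁ δ) T) :
    errProb Ev f n (selOut Ev f n cand P₁ m δ T r) ≤ 2 * δ := by
  obtain ⟨w, hw, hgood⟩ := exists_firstAcc_good hr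
  simp only [selOut, hw]
  exact hgood

/-- **The output is a good circuit with probability `≥ 1 − 1/a`**, over coin strings of ANY length
`L ≥ T·c` (`c = P₁ + m n` the trial block, `T = 4aP` trials, `m = 64D²a²P` test points), when the
weak stage delivers a candidate of error `≤ 1/D` with probability `≥ 1/P`.
[cite: ImpagliazzoWigderson2001, Lemma 14 and Lemma 18 (proofs)] -/
theorem le_uniformProb_selOut_mem {P D a : ℕ} (hP : 1 ≤ P) (hD : 1 ≤ D) (ha : 1 ≤ a)
    (hweak : 1 / (P : ℝ) ≤ uniformProb P₁ {rb | errProb Ev f n (cand rb) ≤ 1 / (D : ℝ)})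
    {L : ℕ} (hL : 4 * a * P * (P₁ + 64 * D ^ 2 * a ^ 2 * P * n) ≤ L) :
    1 - 1 / (a : ℝ) ≤ uniformProb L {r | selOut Ev f n cand P₁ (64 * D ^ 2 * a ^ 2 * P) (1 / (D : ℝ)) (4 * a * P) r ∈
      approxCircuits Ev f (fun _ => 2 / (D : ℝ)) n} := by
  set m := 64 * D ^ 2 * a ^ 2 * P with hm
  set T := 4 * a * P with hT
  set c := P₁ + m * n with hc
  have hmpos : 0 < m := by rw [hm]; positivity
  -- the failure event, on the first `T·c` coins
  have hbad := uniformProb_selectBad_le (Ev := Ev) (f := f) (n := n) (cand := cand) (P₁ := P₁) (m := m)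
    (δ := 1 / (D : ℝ)) hmpos (by positivity) (p := 1 / (P : ℝ)) (by positivity)
    ((div_le_one (by positivity)).2 (by exact_mod_cast hP)) hweak T
  have hinv := selectBad_le_inv hP hD ha
  rw [← hm, ← hT] at hinv
  have hfail : uniformProb (T * c) (Selection.Bad (Acc Ev f n cand P₁ m (1 / (D : ℝ))) c
      (GoodTrial Ev f n cand P₁ (1 / (D : ℝ))) T) ≤ 1 / (a : ℝ) := hbad.trans hinv
  -- transported to length `L`
  obtain ⟨e, he⟩ := Nat.exists_eq_add_of_le hL
  have hfailL : uniformProb L {r | r ∈ Selection.Bad (Acc Ev f n cand P₁ m (1 / (D : ℝ))) c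
      (GoodTrial Ev f n cand P₁ (1 / (D : ℝ))) T} ≤ 1 / (a : ℝ) := by
    have hset : {r : List Bool | r ∈ Selection.Bad (Acc Ev f n cand P₁ m (1 / (D : ℝ))) c
        (GoodTrial Ev f n cand P₁ (1 / (D : ℝ))) T} =
        {r | r.take (T * c) ∈ Selection.Bad (Acc Ev f n cand P₁ m (1 / (D : ℝ))) c
          (GoodTrial Ev f n cand P₁ (1 / (D : ℝ))) T} := by
      ext r; exact Selection.mem_bad_iff_take _ _ _ _ _
    rw [hset, he, hc, uniformProb_take_add]
    rw [hc] at hfail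
    exact hfail
  -- success
  have himp : ∀ r : List Bool, r ∈ {r : List Bool | r ∈ Selection.Bad (Acc Ev f n cand P₁ m (1 / (D : ℝ))) c
      (GoodTrial Ev f n cand P₁ (1 / (D : ℝ))) T}ᶜ →
      r ∈ {r | selOut Ev f n cand P₁ m (1 / (D : ℝ)) T r ∈ approxCircuits Ev f (fun _ => 2 / (D : ℝ)) n} := by
    intro r hr
    rw [Set.mem_setOf_eq, mem_approxCircuits_iff_errProb]
    exact (errProb_selOut_le (T := T) hr).trans_eq (by ring)
  have hmono := uniformProb_mono_of_imp (c := L) himp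
  rw [uniformProb_compl] at hmono
  linarith

end Select

/-- **`A →^{fₙ} C^{f,1−2/D}` from an oracle algorithm that outputs the selected candidate.** If a
polynomial-time oracle algorithm `C` with round budget `b` and coin polynomial `p`, run on
`⟨z, ⟨1^n, ⟨1^a, r⟩⟩⟩` against any oracle agreeing with `f` on `{0,1}^n`, outputs
`selOut … r` for the candidate map `cand n z` of a weak stage of success `≥ 1/P(n)` and error
`≤ 1/D(n)` on `z ∈ Aₙ` (with `T = 4aP(n)` trials, `m = 64D(n)²a²P(n)` test points, run block `P₁(n)`),
and the coins are long enough, then `B = C^{f,1−2/D}` is probabilistic-polynomial-time constructible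
from `A` using `fₙ`. [cite: ImpagliazzoWigderson2001, Def. 4, Lemma 14, Lemma 18 (proof)] -/
theorem reducibleUsing_of_selOut {A : ConstructionProblem} {Ev : List Bool → List Bool} {f : List Bool → Bool}
    {P D P₁ : ℕ → ℕ} (hP : ∀ n, 1 ≤ P n) (hD : ∀ n, 1 ≤ D n)
    {cand : ℕ → List Bool → List Bool → List Bool}
    (hweak : ∀ n, ∀ z ∈ A n, 1 / (P n : ℝ) ≤ uniformProb (P₁ n) {rb | Select.errProb Ev f n (cand n z rb) ≤ 1 / (D n : ℝ)})
    {C : OracleAlg (List Bool)} (hC : C.IsPolyTime (encodingList Bool)) {b p : Polynomial ℕ}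
    (hlen : ∀ (z : List Bool) (n a : ℕ),
      4 * a * P n * (P₁ n + 64 * D n ^ 2 * a ^ 2 * P n * n) ≤ p.eval (z.length + n + a))
    (hrun : ∀ (n a : ℕ), 1 ≤ a → ∀ z ∈ A n, ∀ O : Oracle, AgreesOn O f n → ∀ r : List Bool,
      r.length = p.eval (z.length + n + a) →
      C.run O (b.eval (reduceInput z n a r).length) (reduceInput z n a r) =
        some (Select.selOut Ev f n (cand n z) (P₁ n) (64 * D n ^ 2 * a ^ 2 * P n) (1 / (D n : ℝ)) (4 * a * P n) r)) :
    ReducibleUsing A (approxCircuits Ev f fun n => 2 / (D n : ℝ)) f id := by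
  refine ⟨C, b, p, hC, fun n a ha z hz O hO => ?_⟩
  have h := Select.le_uniformProb_selOut_mem (Ev := Ev) (f := f) (n := n) (cand := cand n z) (P₁ := P₁ n)
    (hP n) (hD n) ha (hweak n z hz) (hlen z n a)
  refine h.trans (uniformProb_mono_of_imp_len' fun r hr hmem => ⟨_, hmem, hrun n a ha z hz O hO r hr⟩)
where
  /-- monotonicity along an implication on strings of the right length (local copy) -/
  uniformProb_mono_of_imp_len' {L : ℕ} {E F : Set (List Bool)}
      (h : ∀ r : List Bool, r.length = L → r ∈ E → r ∈ F) : uniformProb L E ≤ uniformProb L F := by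
    classical
    rw [uniformProb_eq_cnt_div, uniformProb_eq_cnt_div]
    refine div_le_div_of_nonneg_right ?_ (by positivity)
    unfold cnt
    exact_mod_cast Finset.card_le_card fun r hr => by
      simp only [Finset.mem_filter, Finset.mem_univ, true_and] at hr ⊢
      exact h _ (List.Vector.toList_length r) hr

end IWUniform

end Literature.Computability.Complexity

end
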